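import Summits.AtomisticToContinuum.Crystallization.Theorems.PalmUnimodularRigidityLayeredLawsSelectHcpCertificateDefsE
import Summits.AtomisticToContinuum.Crystallization.Theorems.PalmUnimodularRigidityLayeredLawsSelectHcpIterIntCount
import Summits.AtomisticToContinuum.Crystallization.Theorems.PalmUnimodularRigidityLayeredLawsSelectHcpLocalChartIffBall

/-!
# Crux `LayeredLawsSelectHcp` (stmt-AtomisticToContinuum-9226), line `mtp-prestress-split-ergodic-frame`:
# the iterated Campbell integral of the chart weight on a graph ball against `count|S` is the finite chart sum (R3′, lead c3)

Twin of `…IterIntCount.lean`'s `tube_iterInt_count_eq_chartSum` (lead c2, the near ball = graph ball of radius `2`) for the graph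
ball `ballLabels n` of every radius `n ≥ 1` (registered sub-goal `tube_iterInt_count_eq_chartSum_ball`, the anchor).  For a rooted
hcp-charted tube configuration `S ∋ 0` with good shells and a kernel `κ` acting as the identity on `count|S`, the iterated Bochner
integral of the chart weight `chartWeightOn (ballLabels n) e ψ y` (`…CertificateDefsE.lean`) along the list of the ball labels, started
at the zero tuple, evaluates to the finite sum `∑ᶠ_{X rooted chart of S, X e = −y} ψ (X|ballLabels n)`:

* FUBINI FOR COUNTING MEASURES along a duplicate-free label list is label-set agnostic and is REUSED by name
  (`IterIntCount.iterInt_count_eq_finsum`): the iterated integral is the sum of the chart weight over the `S`-valued extensions of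
  the zero tuple along `(ballLabels n).toList` on which it does not vanish, provided they form a finite set;
* those extensions are local chart PATTERNS on the ball with ball values in `S`, i.e. local charts on the ball
  (`isLocalChartOn_iff_pattern`), i.e. — `tube_localChart_iff_ball` — the zero-extended ball restrictions of the finitely many
  (`tube_rootedCharts_ncard`) rooted charts; the restriction map is a bijection onto them (`tube_rootedChart_unique`: the star
  labels lie in every ball of positive radius, `LocalChartIffBall.mem_ballLabels_of_mem_hcpStarIdx`), and on the restriction of `X`
  the chart weight reads `ψ (X|ballLabels n)` (`finsum_mem_eq_of_bijOn`).

All `[folklore]`.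
-/

noncomputable section

namespace Summit.AtomisticToContinuum.Crystallization.Theorems.PalmUnimodularRigidity.LayeredLawsSelectHcp

open MeasureTheory Set ProbabilityTheory
open Literature.MathematicalPhysics.StatisticalMechanics Literature.Geometry.DiscreteGeometry
open Summit.AtomisticToContinuum.Crystallization.Theorems.LayeredLawsSelectHcp.Negative.DiracLaws (GoodShell)

/-- **Registered sub-goal `tube_iterInt_count_eq_chartSum_ball` — the iterated Campbell integral of the chart weight on a graph
ball against a counting measure is the chart sum.**  For `n ≥ 1`, an hcp-charted `S ∋ 0` with good shells and a kernel `κ` with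
`κ (count|S) = count|S`, the iterated integral of `chartWeightOn (ballLabels n) e ψ y` (`e` a label of the ball) along
`(ballLabels n).toList` from the zero tuple equals `∑ᶠ_{X rooted chart of S, X e = −y} ψ (X|ballLabels n)`: by
`IterIntCount.iterInt_count_eq_finsum` it is the sum of the chart weight over the `S`-valued ball tuples, whose members in the
support are local charts on the ball (`isLocalChartOn_iff_pattern`), i.e. (`tube_localChart_iff_ball`) the zero-extended ball
restrictions of the finitely many rooted charts (`tube_rootedCharts_ncard`), in bijection with them (`tube_rootedChart_unique`).
[folklore] -/
theorem tube_iterInt_count_eq_chartSum_ball : ∀ (n : ℕ), 1 ≤ n → ∀ S : Set (EuclideanSpace ℝ (Fin 3)), (0 : EuclideanSpace ℝ (Fin 3)) ∈ S → (∀ x ∈ S, GoodShell S x) → HcpCharted S → ∀ (κ : ProbabilityTheory.Kernel (MeasureTheory.Measure (EuclideanSpace ℝ (Fin 3))) (EuclideanSpace ℝ (Fin 3))), κ ((MeasureTheory.Measure.count : MeasureTheory.Measure (EuclideanSpace ℝ (Fin 3))).restrict S) = (MeasureTheory.Measure.count : MeasureTheory.Measure (EuclideanSpace ℝ (Fin 3))).restrict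 S → ∀ (e : ℤ × ℤ × ℤ), e ∈ ballLabels n → ∀ (ψ : (↥(ballLabels n) → EuclideanSpace ℝ (Fin 3)) → ℝ) (y : EuclideanSpace ℝ (Fin 3)), iterInt κ (ballLabels n).toList (chartWeightOn (ballLabels n) e ψ y) ((MeasureTheory.Measure.count : MeasureTheory.Measure (EuclideanSpace ℝ (Fin 3))).restrict S) 0 = ∑ᶠ X ∈ {X : ℤ × ℤ × ℤ → EuclideanSpace ℝ (Fin 3) | IsRootedChart S X ∧ X e = -y}, ψ (fun u => X u) := by
  intro n hn S h0 hgood hchart κ hκ e he ψ y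
  classical
  -- the local-chart dictionary: local charts on the ball are the ball restrictions of the rooted charts
  have hloc := tube_localChart_iff_ball n hn S h0 hchart
  -- `S` is countable (the image of a chart), hence measurable
  obtain ⟨X₀, -, -, hSX₀, -⟩ := tube_exists_rootedChart S h0 hchart
  have hSm : MeasurableSet S :=
    ((Set.countable_range X₀).mono fun x hx => by
      obtain ⟨u, hu⟩ := hSX₀ x hx
      exact ⟨u, hu⟩).measurableSet
  -- the rooted charts form a finite set
  have hfinR : {X : ℤ × ℤ × ℤ → EuclideanSpace ℝ (Fin 3) | IsRootedChart S X}.Finite := by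
    rw [← rootedCharts_count_restrict]
    exact (tube_rootedCharts_ncard S h0 hgood hchart).1
  -- the `S`-valued extensions of `0` along `(ballLabels n).toList`
  set E : Set (ℤ × ℤ × ℤ → EuclideanSpace ℝ (Fin 3)) :=
    {w | (∀ v ∈ (ballLabels n).toList, w v ∈ S) ∧
      ∀ v, v ∉ (ballLabels n).toList → w v = (0 : ℤ × ℤ × ℤ → EuclideanSpace ℝ (Fin 3)) v}
  -- ball restrictions of rooted charts, extended by zero
  have hres_mem : ∀ X, IsRootedChart S X → (↑(ballLabels n) : Set (ℤ × ℤ × ℤ)).indicator X ∈ E := fun X hX =>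
    ⟨fun v hv => by
      rw [indicator_of_mem (Finset.mem_coe.2 (Finset.mem_toList.1 hv))]
      exact hX.2.1 v,
     fun v hv => by
      rw [indicator_of_notMem (fun h => hv (Finset.mem_toList.2 (Finset.mem_coe.1 h))), Pi.zero_apply]⟩
  have hres_loc : ∀ X, IsRootedChart S X →
      IsLocalChartOn (ballLabels n) S ((↑(ballLabels n) : Set (ℤ × ℤ × ℤ)).indicator X) :=
    fun X hX => (hloc _).2 ⟨X, hX, fun u hu => indicator_of_mem (Finset.mem_coe.2 hu) X⟩
  -- an extension which is a local chart pattern on the ball is the restriction of a rooted chart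
  have hpat : ∀ w ∈ E, IsLocalChartPatternOn (ballLabels n) w →
      ∃ X, IsRootedChart S X ∧ (∀ u ∈ ballLabels n, w u = X u) ∧
        (↑(ballLabels n) : Set (ℤ × ℤ × ℤ)).indicator X = w := fun w hw hp => by
    obtain ⟨X, hX, hwX⟩ := (hloc w).1 ((isLocalChartOn_iff_pattern (ballLabels n) S w).2
      ⟨hp, fun u hu => hw.1 u (Finset.mem_toList.2 hu)⟩)
    refine ⟨X, hX, hwX, funext fun u => ?_⟩
    by_cases hu : u ∈ ballLabels n
    · rw [indicator_of_mem (Finset.mem_coe.2 hu), hwX u hu]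
    · rw [indicator_of_notMem (fun h => hu (Finset.mem_coe.1 h)), hw.2 u (fun h => hu (Finset.mem_toList.1 h)),
        Pi.zero_apply]
  -- off the local chart patterns with `w e = -y` the chart weight vanishes
  have hcw : ∀ w, chartWeightOn (ballLabels n) e ψ y w ≠ 0 → IsLocalChartPatternOn (ballLabels n) w ∧ w e = -y :=
    fun w hw => by
    by_contra h
    exact hw (chartWeightOn_eq_zero_of_not h)
  -- finiteness of the support among the extensions
  have hfin : (E ∩ Function.support (chartWeightOn (ballLabels n) e ψ y)).Finite := by
    refine (hfinR.image fun X => (↑(ballLabels n) : Set (ℤ × ℤ × ℤ)).indicator X).subset ?_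
    rintro w ⟨hw, hwH⟩
    obtain ⟨X, hX, -, hXw⟩ := hpat w hw (hcw w hwH).1
    exact ⟨X, hX, hXw⟩
  rw [IterIntCount.iterInt_count_eq_finsum hSm κ _ hκ (chartWeightOn (ballLabels n) e ψ y) (ballLabels n).toList
    (Finset.nodup_toList _) 0 hfin]
  rw [finsum_mem_inter_support_eq (chartWeightOn (ballLabels n) e ψ y) E
    (E ∩ {w | IsLocalChartPatternOn (ballLabels n) w ∧ w e = -y})
    (Set.ext fun w => ⟨fun ⟨hw, hwH⟩ => ⟨⟨hw, hcw w hwH⟩, hwH⟩, fun ⟨⟨hw, _⟩, hwH⟩ => ⟨hw, hwH⟩⟩)]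
  symm
  refine finsum_mem_eq_of_bijOn (↑(ballLabels n) : Set (ℤ × ℤ × ℤ)).indicator ⟨?_, ?_, ?_⟩ ?_
  · -- maps to
    rintro X ⟨hX, hXe⟩
    refine ⟨hres_mem X hX, ((isLocalChartOn_iff_pattern (ballLabels n) S _).1 (hres_loc X hX)).1, ?_⟩
    rw [indicator_of_mem (Finset.mem_coe.2 he), hXe]
  · -- injective: two rooted charts agreeing on the ball agree on the star, hence are equal
    rintro X ⟨hX, -⟩ X' ⟨hX', -⟩ hXX'
    refine tube_rootedChart_unique S X X' hgood hX hX' fun v hv => ?_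
    have h := congrFun hXX' v
    rwa [indicator_of_mem (Finset.mem_coe.2 (LocalChartIffBall.mem_ballLabels_of_mem_hcpStarIdx hn hv)),
      indicator_of_mem (Finset.mem_coe.2 (LocalChartIffBall.mem_ballLabels_of_mem_hcpStarIdx hn hv))] at h
  · -- onto
    rintro w ⟨hw, hp, hwe⟩
    obtain ⟨X, hX, hwX, hXw⟩ := hpat w hw hp
    exact ⟨X, ⟨hX, by rw [← hwX e he, hwe]⟩, hXw⟩
  · -- values
    rintro X ⟨hX, hXe⟩
    have hc : IsLocalChartPatternOn (ballLabels n) ((↑(ballLabels n) : Set (ℤ × ℤ × ℤ)).indicator X) ∧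
        (↑(ballLabels n) : Set (ℤ × ℤ × ℤ)).indicator X e = -y :=
      ⟨((isLocalChartOn_iff_pattern (ballLabels n) S _).1 (hres_loc X hX)).1,
        by rw [indicator_of_mem (Finset.mem_coe.2 he), hXe]⟩
    rw [chartWeightOn_eq_of hc]
    congr 1
    funext u
    exact (indicator_of_mem (Finset.mem_coe.2 u.2) X).symm

end Summit.AtomisticToContinuum.Crystallization.Theorems.PalmUnimodularRigidity.LayeredLawsSelectHcp

end
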